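import Summits.QuantumFields.BalabanUV.Beta.FP.ConstrainedBiLaplacianSbTwoLevel
import Summits.QuantumFields.BalabanUV.Beta.FP.ConstrainedBiLaplacianResponseTwoLevelEstimate

/-!
# `BalabanUV.Beta.FP.ConstrainedBiLaplacianSbTwoLevelEstimate` — road «FP», brick (g3) «(CONV-C)-Sb», THE TWO-LEG ONE-STEP LAW, FILE E (ESTIMATES):
# at order `s = 2`, on the strip `Strip d (kappaB d 2)`, for EVERY coarse alias (pair) and EVERY `n, L ≥ 1`, the transferred fibre letters are `n⁻²`-close
# to the coarse ones — `‖nsdT k − nsd k‖ ≤ CN∕n²`, `‖Spr_{nL} − Spr_n‖ ≤ 132^d·CN∕n²`, `‖DgT k − Dg k‖ ≤ CD∕n²`, `‖coefT k k′ − coef k k′‖ ≤ CC∕n²`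
# (constants explicit in `d, L`, UNWEIGHTED in the aliases)

NOT IN PRINT; OUR PROOF ATTEMPT (binder row G-an2-4 ∕ (CONV-C), prover part P3 = fibre∕strip «Woodbury» lineage, gen 29; CRUX TEAM (2), 2026-08-21).
HONEST DEPENDENCY (cell records, verbatim): «continuum YM on T⁴ ⇐ BetaPertH ∧ nine spine estimates (0/9 proved); BetaPertH ⇐ (D1) ∧ (D4) ∧ CAP+tail;
G-an2-4 gates asym, D1 and NE2/3/4.»  HONEST FRAMING (cell contract, verbatim): «discharging `BetaPertH` makes Bałaban's UV stability UNCONDITIONAL — a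
real constructive-QFT result; it is NOT the continuum limit and NOT the Clay problem.»  ABSOLUTE RULE (cell charter, verbatim): «No internally-minted
statement may enter as a cited fact. Every hypothesis is either kernel-proved in this package or a verbatim quotation of a PUBLISHED theorem with page
reference. The manuscript(s) under audit are NOT citable for their own disputed steps — they are the thing under adjudication; programme-internal
(2001/route/tribunal) claims are never citable.»  THIS MODULE is [folklore] bookkeeping + our estimates over FILE A1 of this programme (`nsd`, `Dg`,
`nsdT`, `DgT`, `coef_eq`, `coefT_eq`, closed forms) and the lineage's gen-28 letters (`ConstrainedBiLaplacianResponseTwoLevelSymbols.{norm_T2_sub_le,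
norm_T2far_le, norm_W1_zero_sub_one_le, norm_DeltaXi_sq_sub_le, Cden}`, `…TwoLevelEstimate.norm_inv_den_sub_le`, `…Strip.norm_inv_den_le_strip`,
`…Fibre.{norm_ainv_le', norm_Spr_le}`, `B4StripCauchy.sum_norm_U_le`, `SubAveragingFibreColumn.U_mul_Kof`); it cites nothing as a hypothesis, has FOUR
closed-form constants (`CN`, `CS`, `CD`, `CC`) as `def`s, no `def … : Prop`, no `sorry`.

## What is proved (census V69, the analytic one-step content; all on `Strip d (kappaB d 2)`, every `n, L ≥ 1`, constants free of `n, k, k′, p`)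
`Spr_eq_sum_U_nsd`, `Spr_mul_eq` (`Spr_{nL} = Σ_k U_n(k)·nsdT k`); **`norm_nsdT_sub_nsd_le`** (`≤ CN∕n²`, every `k`); **`norm_Spr_mul_sub_le`**
(`≤ 132^d·CN∕n²`); **`norm_DgT_sub_Dg_le`** (`≤ CD∕n²`, every `k`; the zero alias through `Spr`, `W1(0)`, `u_0ũ_0` and the two denominators);
**`norm_coefT_sub_coef_le`** (`≤ CC∕n²`, every pair; FILE A1's two-bilinear forms + product rule) — the inputs of the cell-summed kernel law (FILE R).

0∕4 row-D1 binders touched.  NOT (CONV-C), NEVER «G-an2-4 closed», NOT the ghost step law, NOT SDF, NOT D1, NOT BetaPertH, NOT continuum, NOT Clay.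
Provenance: prover-b2b-balaban-gan24-p3-g29-0 (unit `b2b-balaban-gan24-p3`, gen 29), 2026-08-21; no existing file touched.
-/

noncomputable section

namespace Summit.QuantumFields.BalabanUV.Beta.FP.ConstrainedBiLaplacianSbTwoLevelEstimate

open Complex Finset ComplexConjugate
open Literature.MathematicalPhysics.QuantumFieldTheory.Balaban1983to89
open Literature.MathematicalPhysics.QuantumFieldTheory.Balaban1983to89.B4Strip
open Literature.MathematicalPhysics.QuantumFieldTheory.Balaban1983to89.B4StripCauchy
open Literature.MathematicalPhysics.QuantumFieldTheory.Balaban1983to89.B4StripSums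
open Summit.QuantumFields.BalabanUV.Beta.FP.ConstrainedBiLaplacianStrip
open Summit.QuantumFields.BalabanUV.Beta.FP.ConstrainedBiLaplacianFibre
open Summit.QuantumFields.BalabanUV.Beta.FP.ConstrainedBiLaplacianFibreEntries
open Summit.QuantumFields.BalabanUV.Beta.FP.ConstrainedBiLaplacianFibreIdentities (fat_of_strip)
open Summit.QuantumFields.BalabanUV.Beta.FP.ConstrainedBiLaplacianResponseTwoLevel (T2 T2far Kof_zero_eq_zero_iff)
open Summit.QuantumFields.BalabanUV.Beta.FP.ConstrainedBiLaplacianResponseTwoLevelSymbols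
open Summit.QuantumFields.BalabanUV.Beta.FP.ConstrainedBiLaplacianResponseTwoLevelEstimate (norm_inv_den_sub_le)
open Summit.QuantumFields.BalabanUV.Beta.FP.ConstrainedBiLaplacianSbTwoLevelSymbols
open Summit.QuantumFields.BalabanUV.Beta.FP.ConstrainedBiLaplacianSbTwoLevel
open Summit.QuantumFields.BalabanUV.Beta.GAN24.SubAveragingCore (Kof Kof_val Kof_ne_zero fat_coord)
open Summit.QuantumFields.BalabanUV.Beta.GAN24.SubAveragingCoreEstimate (W1 norm_W1_le)
open Summit.QuantumFields.BalabanUV.Beta.GAN24.SubAveragingFibre (Kof_zero)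
open Summit.QuantumFields.BalabanUV.Beta.GAN24.SubAveragingFibreColumn (sum_Kof_eq U_mul_Kof)
open scoped Real

variable {d : ℕ}

/-! ## §0 Elementary product rules -/
/-- [folklore] `‖a′b′ − ab‖ ≤ ε₁·B′ + A·ε₂` from `‖a′ − a‖ ≤ ε₁`, `‖b′‖ ≤ B′`, `‖a‖ ≤ A`, `‖b′ − b‖ ≤ ε₂`. -/
theorem norm_mul_sub_mul_le' {a a' b b' : ℂ} {A B' ε₁ ε₂ : ℝ} (ha : ‖a' - a‖ ≤ ε₁) (hb' : ‖b'‖ ≤ B') (hA : ‖a‖ ≤ A) (hb : ‖b' - b‖ ≤ ε₂) :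
    ‖a' * b' - a * b‖ ≤ ε₁ * B' + A * ε₂ := by
  have e : a' * b' - a * b = (a' - a) * b' + a * (b' - b) := by ring
  rw [e]
  refine (norm_add_le _ _).trans (add_le_add ?_ ?_)
  · rw [norm_mul]; exact mul_le_mul ha hb' (norm_nonneg _) ((norm_nonneg _).trans ha)
  · rw [norm_mul]; exact mul_le_mul hA hb (norm_nonneg _) ((norm_nonneg _).trans hA)

/-! ## §1 The regular part of the denominator through the letters -/

section Spr

variable (N : ℕ) [NeZero N] (s : ℕ) (p : Fin d → ℂ)

/-- [folklore] `Spr_N = Σ_K U_K·nsd_K` (the zero alias contributes nothing). -/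
theorem Spr_eq_sum_U_nsd : Spr N s p = ∑ K : Fin d → Fin N, U N K p * nsd N s p K := by
  unfold Spr
  rw [← Finset.add_sum_erase Finset.univ _ (Finset.mem_univ (fun _ => (0 : Fin N))), nsd_zero, mul_zero, zero_add]
  exact Finset.sum_congr rfl fun K hK => by rw [nsd_of_ne N s p (Finset.ne_of_mem_erase hK)]

end Spr

/-- [folklore] **THE FINER REGULAR PART THROUGH THE COARSE ALIASES**: `Spr (n·L) s p = Σ_k U n k p·nsdT n L s p k` on the fat region (`U_{nL}(Kof k m) = U_n(k)·W1`). -/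
theorem Spr_mul_eq (n L : ℕ) [NeZero n] [NeZero L] (s : ℕ) {r : ℝ} (hr : r ≤ 1 / 4) {p : Fin d → ℂ} (hp : p ∈ Fat d r) :
    Spr (n * L) s p = ∑ k : Fin d → Fin n, U n k p * nsdT n L s p k := by
  rw [Spr_eq_sum_U_nsd, sum_Kof_eq n L]
  refine Finset.sum_congr rfl fun k _ => ?_
  unfold nsdT
  rw [Finset.mul_sum]
  exact Finset.sum_congr rfl fun m _ => by rw [U_mul_Kof n L hr hp]; ring

/-! ## §2 The constants -/
/-- [folklore] `CN d L = C2 d L + L^d·4^{d+2}·(64∕7)²` — the off-zero diagonal letter's constant (both cases `k ≠ 0`, `k = 0`). -/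
def CN (d L : ℕ) : ℝ := C2 d L + (L : ℝ) ^ d * 4 ^ (d + 2) * (64 / 7) ^ 2

/-- [folklore] `CS d L = CN d L + 4^d·91·d` — the side factor's constant. -/
def CS (d L : ℕ) : ℝ := CN d L + 4 ^ d * 91 * (d : ℝ)

/-- [folklore] The diagonal letter's constant. -/
def CD (d L : ℕ) : ℝ :=
  CN d L + (4 ^ d * 91 * (d : ℝ)) * (132 ^ d * (64 / 7) ^ 2 + 4 ^ d * 144 ^ d) / cB d
    + (132 ^ d * CN d L + 4 ^ d * 91 * (d : ℝ) * 144 ^ d) / cB d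
    + (132 ^ d * (64 / 7) ^ 2 + 144 ^ d) * (Cden d L / cB d ^ 2) + (L : ℝ) ^ d * 4 ^ (d + 2) * (64 / 7) ^ 2

/-- [folklore] The rank-one coefficient's constant. -/
def CC (d L : ℕ) : ℝ :=
  (CS d L * ((64 / 7) ^ 2 + 1 + CS d L) + ((64 / 7) ^ 2 + 1) * CS d L
    + 16384 * (d : ℝ) ^ 2 * (((64 / 7) ^ 2 + CN d L) * ((64 / 7) ^ 2 + CN d L))
    + ((16 * (d : ℝ)) ^ 2 + 1) * (CN d L * ((64 / 7) ^ 2 + CN d L) + (64 / 7) ^ 2 * CN d L)) / cB d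
  + (((64 / 7) ^ 2 + 1) ^ 2 + ((16 * (d : ℝ)) ^ 2 + 1) * ((64 / 7) ^ 2 * (64 / 7) ^ 2)) * (Cden d L / cB d ^ 2)

/-- [folklore] `0 ≤ CN`. -/
theorem CN_nonneg (d L : ℕ) : 0 ≤ CN d L := by unfold CN; have := C2_nonneg d L; positivity
/-- [folklore] `0 ≤ CS`. -/
theorem CS_nonneg (d L : ℕ) : 0 ≤ CS d L := by unfold CS; have := CN_nonneg d L; positivity
/-- [folklore] `0 ≤ CD`. -/
theorem CD_nonneg (d L : ℕ) : 0 ≤ CD d L := by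
  unfold CD; have := CN_nonneg d L; have := Cden_nonneg d L; have := cB_pos d; positivity
/-- [folklore] `0 ≤ CC`. -/
theorem CC_nonneg (d L : ℕ) : 0 ≤ CC d L := by
  unfold CC; have := CN_nonneg d L; have := CS_nonneg d L; have := Cden_nonneg d L; have := cB_pos d; positivity
/-- [folklore] `C2 ≤ CN`. -/
theorem C2_le_CN (d L : ℕ) : C2 d L ≤ CN d L := by
  unfold CN; have : (0 : ℝ) ≤ (L : ℝ) ^ d * 4 ^ (d + 2) * (64 / 7) ^ 2 := by positivity
  linarith
/-- [folklore] `CN ≤ CD`. -/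
theorem CN_le_CD (d L : ℕ) : CN d L ≤ CD d L := by
  have hcB := cB_pos d; have hCN := CN_nonneg d L; have hCden := Cden_nonneg d L
  have h1 : (0 : ℝ) ≤ (L : ℝ) ^ d * 4 ^ (d + 2) * (64 / 7) ^ 2 := by positivity
  have h2 : 0 ≤ (4 ^ d * 91 * (d : ℝ)) * (132 ^ d * (64 / 7) ^ 2 + 4 ^ d * 144 ^ d) / cB d := by positivity
  have h3 : 0 ≤ (132 ^ d * CN d L + 4 ^ d * 91 * (d : ℝ) * 144 ^ d) / cB d := by positivity
  have h4 : 0 ≤ (132 ^ d * (64 / 7) ^ 2 + 144 ^ d) * (Cden d L / cB d ^ 2) := by positivity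
  unfold CD; linarith

/-! ## §2b The zero-alias block-averaging product -/

/-- [folklore] `u′_0 ũ′_0 = W1(Kof 0 0)·u_0 ũ_0` (the finer zero-alias block-averaging product through the sub-block weight). -/
theorem F_Fc_zero_mul (n L : ℕ) [NeZero n] [NeZero L] (p : Fin d → ℂ) :
    F (n * L) (fun _ => 0) (fun _ => 0) p * Fc (n * L) (fun _ => 0) (fun _ => 0) p
    = W1 n L (Kof n L (fun _ => 0) (fun _ => 0)) p * (F n (fun _ => 0) (fun _ => 0) p * Fc n (fun _ => 0) (fun _ => 0) p) := by
  have h1 := F_zero_Kof n L (fun _ => (0 : Fin n)) (fun _ => (0 : Fin L)) p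
  have h2 := Fc_zero_Kof n L (fun _ => (0 : Fin n)) (fun _ => (0 : Fin L)) p
  have h3 := GP_mul_GM n L (Kof n L (fun _ => (0 : Fin n)) (fun _ => (0 : Fin L))) p
  rw [Kof_zero] at h1 h2 h3 ⊢
  rw [h1, h2, ← h3]; ring

/-- [folklore] `‖u_0 ũ_0‖ ≤ 144^d` on the fat region. -/
theorem norm_F_Fc_zero_le (n : ℕ) [NeZero n] {r : ℝ} (hr : r ≤ 1 / 4) {p : Fin d → ℂ} (hfat : p ∈ Fat d r) :
    ‖F n (fun _ => 0) (fun _ => 0) p * Fc n (fun _ => 0) (fun _ => 0) p‖ ≤ 144 ^ d := by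
  have hn : 1 ≤ n := Nat.pos_of_ne_zero (NeZero.ne n)
  have h1 := norm_F_zero_le n hr (fun _ => (0 : Fin n)) hfat
  have h2 := norm_Fc_zero_le n hr (fun _ => (0 : Fin n)) hfat
  have e : (∏ _ν : Fin d, 12 / omega n ((fun _ => (0 : Fin n)) _ν)) = (12 : ℝ) ^ d := by
    simp [omega_zero n hn]
  rw [e] at h1 h2
  rw [norm_mul, show (144 : ℝ) ^ d = 12 ^ d * 12 ^ d by rw [← mul_pow]; norm_num]
  exact mul_le_mul h1 h2 (norm_nonneg _) (by positivity)

/-! ## §3 The letter estimates on the strip at order 2 -/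
section Estimates

variable (n L : ℕ) [NeZero n] [NeZero L] {p : Fin d → ℂ} (hp : p ∈ Strip d (kappaB d 2))
include hp

/-- [folklore] `‖nsd n 2 p k‖ ≤ (64∕7)²`. -/
theorem norm_nsd_le (k : Fin d → Fin n) : ‖nsd n 2 p k‖ ≤ (64 / 7) ^ 2 := by
  by_cases hk : k = fun _ => 0
  · rw [hk, nsd_zero, norm_zero]; positivity
  · rw [nsd_of_ne n 2 p hk]; exact norm_ainv_le' n 2 (rOf_le d) (d_mul_rOf_sq_le d) (fat_of_strip 2 hp) k hk

/-- [folklore] `‖side n 2 k p‖ ≤ (64∕7)² + 1`. -/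
theorem norm_side_le' (k : Fin d → Fin n) : ‖side n 2 k p‖ ≤ (64 / 7) ^ 2 + 1 := by
  rw [side_eq_nsd]
  refine (norm_add_le _ _).trans (add_le_add (norm_nsd_le n hp k) ?_)
  split_ifs <;> simp

/-- [our proof] **`‖nsdT k − nsd k‖ ≤ CN∕n²` FOR EVERY ALIAS `k`**. -/
theorem norm_nsdT_sub_nsd_le (k : Fin d → Fin n) : ‖nsdT n L 2 p k - nsd n 2 p k‖ ≤ CN d L / (n : ℝ) ^ 2 := by
  have hfat := fat_of_strip 2 hp
  have hC2 := C2_nonneg d L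
  have hn0 : (0 : ℝ) < n := by exact_mod_cast Nat.pos_of_ne_zero (NeZero.ne n)
  by_cases hk : k = fun _ => 0
  · subst hk
    rw [nsdT_zero, nsd_zero, sub_zero]
    refine (norm_T2far_le n L (rOf_le d) (d_mul_rOf_sq_le d) hfat).trans ?_
    unfold CN; gcongr; linarith
  · rw [nsdT_of_ne n L 2 p hk, nsd_of_ne n 2 p hk]
    refine (norm_T2_sub_le n L (rOf_le d) (d_mul_rOf_sq_le d) hfat hk).trans ?_
    have : (0 : ℝ) ≤ (L : ℝ) ^ d * 4 ^ (d + 2) * (64 / 7) ^ 2 := by positivity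
    unfold CN; gcongr; linarith

/-- [folklore] `‖nsdT k‖ ≤ (64∕7)² + CN`. -/
theorem norm_nsdT_le (k : Fin d → Fin n) : ‖nsdT n L 2 p k‖ ≤ (64 / 7) ^ 2 + CN d L := by
  have h1 := norm_nsdT_sub_nsd_le n L hp k
  have h2 := norm_nsd_le n hp k
  have hn1 : (1 : ℝ) ≤ (n : ℝ) ^ 2 := one_le_pow₀ (by exact_mod_cast Nat.pos_of_ne_zero (NeZero.ne n))
  have h3 : CN d L / (n : ℝ) ^ 2 ≤ CN d L := div_le_self (CN_nonneg d L) hn1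
  calc ‖nsdT n L 2 p k‖ = ‖nsd n 2 p k + (nsdT n L 2 p k - nsd n 2 p k)‖ := by ring_nf
    _ ≤ (64 / 7) ^ 2 + CN d L := (norm_add_le _ _).trans (add_le_add h2 (h1.trans h3))

/-- [folklore] The transferred side factor against the coarse one: `‖(nsdT k + [k=0]W1(0)) − side k‖ ≤ CS∕n²`. -/
theorem norm_sideT_sub_side_le (k : Fin d → Fin n) :
    ‖(nsdT n L 2 p k + (if k = fun _ => (0 : Fin n) then W1 n L (Kof n L (fun _ => 0) (fun _ => 0)) p else 0)) - side n 2 k p‖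
      ≤ CS d L / (n : ℝ) ^ 2 := by
  have hfat := fat_of_strip 2 hp
  have h1 := norm_nsdT_sub_nsd_le n L hp k
  have hCN := CN_nonneg d L
  rw [side_eq_nsd]
  have e : nsdT n L 2 p k + (if k = fun _ => (0 : Fin n) then W1 n L (Kof n L (fun _ => 0) (fun _ => 0)) p else 0)
      - (nsd n 2 p k + if k = fun _ => (0 : Fin n) then 1 else 0)
      = (nsdT n L 2 p k - nsd n 2 p k)
        + (if k = fun _ => (0 : Fin n) then W1 n L (Kof n L (fun _ => 0) (fun _ => 0)) p - 1 else 0) := by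
    split_ifs <;> ring
  rw [e]
  refine (norm_add_le _ _).trans ?_
  unfold CS
  rw [add_div]
  refine add_le_add h1 ?_
  split_ifs
  · exact norm_W1_zero_sub_one_le n L (rOf_le d) hfat
  · rw [norm_zero]; positivity

/-- [folklore] `‖sideT k‖ ≤ (64∕7)² + 1 + CS`. -/
theorem norm_sideT_le (k : Fin d → Fin n) :
    ‖nsdT n L 2 p k + (if k = fun _ => (0 : Fin n) then W1 n L (Kof n L (fun _ => 0) (fun _ => 0)) p else 0)‖ ≤ (64 / 7) ^ 2 + 1 + CS d L := by
  have h1 := norm_sideT_sub_side_le n L hp k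
  have h2 := norm_side_le' n hp k
  have hn1 : (1 : ℝ) ≤ (n : ℝ) ^ 2 := one_le_pow₀ (by exact_mod_cast Nat.pos_of_ne_zero (NeZero.ne n))
  have h3 : CS d L / (n : ℝ) ^ 2 ≤ CS d L := div_le_self (CS_nonneg d L) hn1
  set X := nsdT n L 2 p k + (if k = fun _ => (0 : Fin n) then W1 n L (Kof n L (fun _ => 0) (fun _ => 0)) p else 0)
  calc ‖X‖ = ‖side n 2 k p + (X - side n 2 k p)‖ := by ring_nf
    _ ≤ (64 / 7) ^ 2 + 1 + CS d L := (norm_add_le _ _).trans (add_le_add h2 (h1.trans h3))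

/-- [our proof] **`‖Spr (n·L) 2 p − Spr n 2 p‖ ≤ 132^d·CN∕n²`**. -/
theorem norm_Spr_mul_sub_le : ‖Spr (n * L) 2 p - Spr n 2 p‖ ≤ 132 ^ d * CN d L / (n : ℝ) ^ 2 := by
  have hfat := fat_of_strip 2 hp
  have hCN := CN_nonneg d L
  rw [Spr_mul_eq n L 2 (rOf_le d) hfat, Spr_eq_sum_U_nsd, ← Finset.sum_sub_distrib]
  calc ‖∑ k : Fin d → Fin n, (U n k p * nsdT n L 2 p k - U n k p * nsd n 2 p k)‖
      ≤ ∑ k : Fin d → Fin n, ‖U n k p * nsdT n L 2 p k - U n k p * nsd n 2 p k‖ := norm_sum_le _ _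
    _ ≤ ∑ k : Fin d → Fin n, ‖U n k p‖ * (CN d L / (n : ℝ) ^ 2) := Finset.sum_le_sum fun k _ => by
        rw [← mul_sub, norm_mul]; exact mul_le_mul_of_nonneg_left (norm_nsdT_sub_nsd_le n L hp k) (norm_nonneg _)
    _ = (∑ k : Fin d → Fin n, ‖U n k p‖) * (CN d L / (n : ℝ) ^ 2) := by rw [Finset.sum_mul]
    _ ≤ 132 ^ d * (CN d L / (n : ℝ) ^ 2) := mul_le_mul_of_nonneg_right (sum_norm_U_le n (rOf_le d) hfat) (by positivity)
    _ = _ := by ring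

/-- [our proof] **`‖DgT k − Dg k‖ ≤ CD∕n²` FOR EVERY ALIAS `k`**. -/
theorem norm_DgT_sub_Dg_le (k : Fin d → Fin n) : ‖DgT n L 2 p k - Dg n 2 p k‖ ≤ CD d L / (n : ℝ) ^ 2 := by
  have hn : 1 ≤ n := Nat.pos_of_ne_zero (NeZero.ne n)
  have hL : 1 ≤ L := Nat.pos_of_ne_zero (NeZero.ne L)
  have hn0 : (0 : ℝ) < n := by exact_mod_cast hn
  have hfat := fat_of_strip 2 hp
  have hr := rOf_le d
  have hdr := d_mul_rOf_sq_le d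
  have hcB := cB_pos d
  have hCN := CN_nonneg d L
  have hCden := Cden_nonneg d L
  by_cases hk : k = fun _ => 0
  · subst hk
    rw [DgT_zero, Dg_zero, Dg_zero, F_Fc_zero_mul n L p]
    set w := W1 n L (Kof n L (fun _ => 0) (fun _ => 0)) p with hw
    set uu := F n (fun _ => 0) (fun _ => 0) p * Fc n (fun _ => 0) (fun _ => 0) p with huu
    set S' := Spr (n * L) 2 p
    set S := Spr n 2 p
    set D' := den (n * L) 2 p
    set D := den n 2 p
    -- bounds
    have hw1 : ‖w - 1‖ ≤ 4 ^ d * 91 * (d : ℝ) / (n : ℝ) ^ 2 := norm_W1_zero_sub_one_le n L hr hfat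
    have hw4 : ‖w‖ ≤ 4 ^ d := norm_W1_le n L hn hL _ fun ν => (fat_coord hr hfat ν).2.2
    have hS' : ‖S'‖ ≤ 132 ^ d * (64 / 7) ^ 2 := norm_Spr_le (n * L) 2 hr hdr hfat
    have hS : ‖S‖ ≤ 132 ^ d * (64 / 7) ^ 2 := norm_Spr_le n 2 hr hdr hfat
    have huu' : ‖uu‖ ≤ 144 ^ d := norm_F_Fc_zero_le n hr hfat
    have hSS : ‖S' - S‖ ≤ 132 ^ d * CN d L / (n : ℝ) ^ 2 := norm_Spr_mul_sub_le n L hp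
    have hD' : ‖D'⁻¹‖ ≤ (cB d)⁻¹ := norm_inv_den_le_strip (n * L) 2 hp
    have hDD : ‖D'⁻¹ - D⁻¹‖ ≤ Cden d L / cB d ^ 2 / (n : ℝ) ^ 2 := norm_inv_den_sub_le n L hp
    have hfar : ‖T2far n L 2 p‖ ≤ (L : ℝ) ^ d * 4 ^ (d + 2) * (64 / 7) ^ 2 / (n : ℝ) ^ 2 := norm_T2far_le n L hr hdr hfat
    -- decomposition
    have e : w * ((S' + w * uu) / D') + T2far n L 2 p - (S + uu) / D
        = (w - 1) * (S' + w * uu) * D'⁻¹ + ((S' - S) + (w - 1) * uu) * D'⁻¹ + (S + uu) * (D'⁻¹ - D⁻¹) + T2far n L 2 p := by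
      rw [div_eq_mul_inv, div_eq_mul_inv]; ring
    rw [e]
    have hY' : ‖S' + w * uu‖ ≤ 132 ^ d * (64 / 7) ^ 2 + 4 ^ d * 144 ^ d :=
      (norm_add_le _ _).trans (add_le_add hS' (by rw [norm_mul]; exact mul_le_mul hw4 huu' (norm_nonneg _) (by positivity)))
    have hY : ‖S + uu‖ ≤ 132 ^ d * (64 / 7) ^ 2 + 144 ^ d := (norm_add_le _ _).trans (add_le_add hS huu')
    have t1 : ‖(w - 1) * (S' + w * uu) * D'⁻¹‖ ≤ (4 ^ d * 91 * (d : ℝ) / (n : ℝ) ^ 2) * (132 ^ d * (64 / 7) ^ 2 + 4 ^ d * 144 ^ d) * (cB d)⁻¹ := by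
      rw [norm_mul, norm_mul]
      exact mul_le_mul (mul_le_mul hw1 hY' (norm_nonneg _) (by positivity)) hD' (norm_nonneg _) (by positivity)
    have t2 : ‖((S' - S) + (w - 1) * uu) * D'⁻¹‖ ≤ (132 ^ d * CN d L / (n : ℝ) ^ 2 + (4 ^ d * 91 * (d : ℝ) / (n : ℝ) ^ 2) * 144 ^ d) * (cB d)⁻¹ := by
      rw [norm_mul]
      refine mul_le_mul ((norm_add_le _ _).trans (add_le_add hSS ?_)) hD' (norm_nonneg _) (by positivity)
      rw [norm_mul]; exact mul_le_mul hw1 huu' (norm_nonneg _) (by positivity)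
    have t3 : ‖(S + uu) * (D'⁻¹ - D⁻¹)‖ ≤ (132 ^ d * (64 / 7) ^ 2 + 144 ^ d) * (Cden d L / cB d ^ 2 / (n : ℝ) ^ 2) := by
      rw [norm_mul]; exact mul_le_mul hY hDD (norm_nonneg _) (by positivity)
    refine (norm_add_le _ _).trans ((add_le_add ((norm_add_le _ _).trans (add_le_add ((norm_add_le _ _).trans (add_le_add t1 t2)) t3)) hfar).trans ?_)
    unfold CD
    rw [show (4 ^ d * 91 * (d : ℝ) / (n : ℝ) ^ 2) * (132 ^ d * (64 / 7) ^ 2 + 4 ^ d * 144 ^ d) * (cB d)⁻¹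
        + (132 ^ d * CN d L / (n : ℝ) ^ 2 + (4 ^ d * 91 * (d : ℝ) / (n : ℝ) ^ 2) * 144 ^ d) * (cB d)⁻¹
        + (132 ^ d * (64 / 7) ^ 2 + 144 ^ d) * (Cden d L / cB d ^ 2 / (n : ℝ) ^ 2)
        + (L : ℝ) ^ d * 4 ^ (d + 2) * (64 / 7) ^ 2 / (n : ℝ) ^ 2
        = ((4 ^ d * 91 * (d : ℝ)) * (132 ^ d * (64 / 7) ^ 2 + 4 ^ d * 144 ^ d) / cB d
          + (132 ^ d * CN d L + 4 ^ d * 91 * (d : ℝ) * 144 ^ d) / cB d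
          + (132 ^ d * (64 / 7) ^ 2 + 144 ^ d) * (Cden d L / cB d ^ 2) + (L : ℝ) ^ d * 4 ^ (d + 2) * (64 / 7) ^ 2) / (n : ℝ) ^ 2 by
      field_simp]
    gcongr
    linarith
  · rw [DgT_of_ne n L 2 p hk, Dg_of_ne n 2 p hk]
    refine (norm_T2_sub_le n L hr hdr hfat hk).trans ?_
    gcongr
    exact (C2_le_CN d L).trans (CN_le_CD d L)

/-- [our proof] **`‖coefT k k′ − coef k k′‖ ≤ CC∕n²` FOR EVERY ALIAS PAIR** (the two-bilinear closed forms of FILE A1 and the product rule). -/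
theorem norm_coefT_sub_coef_le (k k' : Fin d → Fin n) : ‖coefT n L 2 p k k' - coef n 2 k k' p‖ ≤ CC d L / (n : ℝ) ^ 2 := by
  have hn : 1 ≤ n := Nat.pos_of_ne_zero (NeZero.ne n)
  have hnL : 1 ≤ n * L := Nat.pos_of_ne_zero (NeZero.ne (n * L))
  have hn0 : (0 : ℝ) < n := by exact_mod_cast hn
  have hfat := fat_of_strip 2 hp
  have hr := rOf_le d
  have hdr := d_mul_rOf_sq_le d
  have hcB := cB_pos d
  have hCN := CN_nonneg d L
  have hCS := CS_nonneg d L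
  have hCden := Cden_nonneg d L
  rw [coefT_eq, coef_eq]
  set ST := nsdT n L 2 p k + (if k = fun _ => (0 : Fin n) then W1 n L (Kof n L (fun _ => 0) (fun _ => 0)) p else 0)
  set ST' := nsdT n L 2 p k' + (if k' = fun _ => (0 : Fin n) then W1 n L (Kof n L (fun _ => 0) (fun _ => 0)) p else 0)
  set NT := nsdT n L 2 p k
  set NT' := nsdT n L 2 p k'
  set Sd := side n 2 k p
  set Sd' := side n 2 k' p
  set Nd := nsd n 2 p k
  set Nd' := nsd n 2 p k'
  set A' := DeltaXi (n * L) 0 p ^ 2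
  set A := DeltaXi n 0 p ^ 2
  set D' := den (n * L) 2 p
  set D := den n 2 p
  -- bounds on letters
  have bS : ‖Sd‖ ≤ (64 / 7) ^ 2 + 1 := norm_side_le' n hp k
  have bS' : ‖Sd'‖ ≤ (64 / 7) ^ 2 + 1 := norm_side_le' n hp k'
  have bST' : ‖ST'‖ ≤ (64 / 7) ^ 2 + 1 + CS d L := norm_sideT_le n L hp k'
  have bN : ‖Nd‖ ≤ (64 / 7) ^ 2 := norm_nsd_le n hp k
  have bNT : ‖NT‖ ≤ (64 / 7) ^ 2 + CN d L := norm_nsdT_le n L hp k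
  have bNT' : ‖NT'‖ ≤ (64 / 7) ^ 2 + CN d L := norm_nsdT_le n L hp k'
  have dS : ‖ST - Sd‖ ≤ CS d L / (n : ℝ) ^ 2 := norm_sideT_sub_side_le n L hp k
  have dS' : ‖ST' - Sd'‖ ≤ CS d L / (n : ℝ) ^ 2 := norm_sideT_sub_side_le n L hp k'
  have dN : ‖NT - Nd‖ ≤ CN d L / (n : ℝ) ^ 2 := norm_nsdT_sub_nsd_le n L hp k
  have dN' : ‖NT' - Nd'‖ ≤ CN d L / (n : ℝ) ^ 2 := norm_nsdT_sub_nsd_le n L hp k'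
  have bA : ‖A‖ ≤ (16 * (d : ℝ)) ^ 2 := by
    have h := norm_DeltaXi_le n hn 0 le_rfl hr hfat; rw [add_zero] at h
    rw [norm_pow]; exact pow_le_pow_left₀ (norm_nonneg _) h 2
  have bA1 : ‖A - 1‖ ≤ (16 * (d : ℝ)) ^ 2 + 1 := (norm_sub_le _ _).trans (by rw [norm_one]; linarith)
  have bA'1 : ‖A' - 1‖ ≤ (16 * (d : ℝ)) ^ 2 + 1 := by
    have h := norm_DeltaXi_le (n * L) hnL 0 le_rfl hr hfat; rw [add_zero] at h
    refine (norm_sub_le _ _).trans ?_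
    rw [norm_one, norm_pow]; linarith [pow_le_pow_left₀ (norm_nonneg _) h 2]
  have dA : ‖(A' - 1) - (A - 1)‖ ≤ 16384 * (d : ℝ) ^ 2 / (n : ℝ) ^ 2 := by
    rw [show (A' - 1) - (A - 1) = A' - A by ring]; exact norm_DeltaXi_sq_sub_le n L hr hfat
  have hD' : ‖D'⁻¹‖ ≤ (cB d)⁻¹ := norm_inv_den_le_strip (n * L) 2 hp
  have hDD : ‖D'⁻¹ - D⁻¹‖ ≤ Cden d L / cB d ^ 2 / (n : ℝ) ^ 2 := norm_inv_den_sub_le n L hp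
  -- numerators
  set X' := ST * ST' + (A' - 1) * NT * NT'
  set X := Sd * Sd' + (A - 1) * Nd * Nd'
  have bX : ‖X‖ ≤ ((64 / 7) ^ 2 + 1) ^ 2 + ((16 * (d : ℝ)) ^ 2 + 1) * ((64 / 7) ^ 2 * (64 / 7) ^ 2) := by
    refine (norm_add_le _ _).trans (add_le_add ?_ ?_)
    · rw [norm_mul, sq]; exact mul_le_mul bS bS' (norm_nonneg _) (by positivity)
    · rw [norm_mul, norm_mul, mul_assoc]
      exact mul_le_mul bA1 (mul_le_mul bN (norm_nsd_le n hp k') (norm_nonneg _) (by positivity)) (by positivity) (by positivity)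
  have dX : ‖X' - X‖ ≤ (CS d L * ((64 / 7) ^ 2 + 1 + CS d L) + ((64 / 7) ^ 2 + 1) * CS d L
      + 16384 * (d : ℝ) ^ 2 * (((64 / 7) ^ 2 + CN d L) * ((64 / 7) ^ 2 + CN d L))
      + ((16 * (d : ℝ)) ^ 2 + 1) * (CN d L * ((64 / 7) ^ 2 + CN d L) + (64 / 7) ^ 2 * CN d L)) / (n : ℝ) ^ 2 := by
    have e : X' - X = (ST * ST' - Sd * Sd') + ((A' - 1) * (NT * NT') - (A - 1) * (Nd * Nd')) := by
      simp only [X', X]; ring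
    rw [e]
    have p1 : ‖ST * ST' - Sd * Sd'‖ ≤ CS d L / (n : ℝ) ^ 2 * ((64 / 7) ^ 2 + 1 + CS d L) + ((64 / 7) ^ 2 + 1) * (CS d L / (n : ℝ) ^ 2) :=
      norm_mul_sub_mul_le' dS bST' bS dS'
    have p2a : ‖NT * NT' - Nd * Nd'‖ ≤ CN d L / (n : ℝ) ^ 2 * ((64 / 7) ^ 2 + CN d L) + (64 / 7) ^ 2 * (CN d L / (n : ℝ) ^ 2) :=
      norm_mul_sub_mul_le' dN bNT' bN dN'
    have bNN' : ‖NT * NT'‖ ≤ ((64 / 7) ^ 2 + CN d L) * ((64 / 7) ^ 2 + CN d L) := by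
      rw [norm_mul]; exact mul_le_mul bNT bNT' (norm_nonneg _) (by positivity)
    have p2 : ‖(A' - 1) * (NT * NT') - (A - 1) * (Nd * Nd')‖
        ≤ 16384 * (d : ℝ) ^ 2 / (n : ℝ) ^ 2 * (((64 / 7) ^ 2 + CN d L) * ((64 / 7) ^ 2 + CN d L))
          + ((16 * (d : ℝ)) ^ 2 + 1) * (CN d L / (n : ℝ) ^ 2 * ((64 / 7) ^ 2 + CN d L) + (64 / 7) ^ 2 * (CN d L / (n : ℝ) ^ 2)) :=
      norm_mul_sub_mul_le' dA bNN' bA1 p2a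
    refine (norm_add_le _ _).trans ((add_le_add p1 p2).trans (le_of_eq ?_))
    field_simp
    ring
  -- assemble
  have e : X' / D' - X / D = (X' - X) * D'⁻¹ + X * (D'⁻¹ - D⁻¹) := by rw [div_eq_mul_inv, div_eq_mul_inv]; ring
  rw [e]
  refine (norm_add_le _ _).trans ?_
  rw [norm_mul, norm_mul]
  refine (add_le_add (mul_le_mul dX hD' (norm_nonneg _) (by positivity)) (mul_le_mul bX hDD (norm_nonneg _) (by positivity))).trans (le_of_eq ?_)
  unfold CC
  field_simp

end Estimates

end Summit.QuantumFields.BalabanUV.Beta.FP.ConstrainedBiLaplacianSbTwoLevelEstimate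

end
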